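import Literature.IUT.HodgeArakelov.FlTorsorConjActFaithful
import Literature.IUT.HodgeArakelov.FlTorsorOuterIsoDetermined
import HarnessLib

/-!
# [IUTchII] Def 2.3 (v) — SUCCESSOR of the `𝔽^±_l`-torsor interface: `conjAct` IS conjugation
# (the repaired statement of GAP-LEDGER G-w5d243-1: laws `conj_stable` + `conjAct_spec`)

S. Mochizuki, *Inter-universal Teichmüller theory II*, kurims manuscript (Dec. 2020), §2: Def 2.3 (ii) p. 68 (cuspidal
inertia groups of `Π_⊆`), Def 2.3 (iii) p. 68 (`LabCusp^±(Π_⊆)`), Def 2.3 (v) p. 69 («the natural action of `Π_⊇/Π_⊆` on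
`Π_⊆` preserves this `𝔽^±_l`-torsor structure, hence determines a natural outer isomorphism `Π_⊇/Π_⊆ ≅ 𝔽_l^{⋊±}»,
`Π_⊆ = Π̂^±_v`, `Π_⊇ = Π̂^cor_v`), Rmk 2.3.1 p. 69 («the cuspidal inertia groups … are permuted by the conjugation action
of `Π^cor_v`») [claim: Mochizuki2012, status: disputed] (IUTchII §2 Def 2.3 (v), kurims p.69) (D-0012 claim key;
record-only typing; nothing printed is asserted here).

WHY THIS FILE (abc-iut cell, GAP-LEDGER row G-w5d243-1 = FREEZE-L6 disclosure X-w5d243-TW1; seat abc-iut-w5-d243 gen 4;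
abc-iut-L6-lead §F v1.19v (2): «the strengthened law lands as a NEW post-freeze def-bearing successor», the frozen
interface file `LabelClassesOfCusps.lean` (abc-iut-L6-t1) being left byte-identical).  In the typed interface
`FlTorsorStructure C` the field `conjAct : Π̂^cor_v → LabCusp^±(Π̂^±_v) → LabCusp^±(Π̂^±_v)` («the conjugation action of
`Π̂^cor_v` on label classes») is constrained ONLY by the chart law `conjAct_chart`; the kernel counter-model
`FlTorsorToy.not_exists_conjAct_eq_conj` (p430806) shows an inhabitant whose `conjAct` is provably NOT conjugation.  Here:

* `CuspidalInertiaData.ConjStable C` — LAW (a): the cuspidal inertia subgroups of the NORMAL subgroup `Π̂^±_v` are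
  permuted by `Π̂^cor_v`-conjugation (print: Rmk 2.3.1);
* under (a), conjugation DESCENDS to the label classes: `ConjStable.conjClass hC g : LabCusp^±(Π̂^±_v) → LabCusp^±(Π̂^±_v)`
  (`labelRel_conj`: `N_{Π̂^±_v}(I^g) = N_{Π̂^±_v}(I)^g` since `g` normalises `Π̂^±_v`) — a `Π̂^cor_v`-action
  (`conjClass_one`, `conjClass_mul`) TRIVIAL on `Π̂^±_v` (`conjClass_eq_self_of_mem_pmHat`), i.e. an action of
  `Π̂^cor_v/Π̂^±_v` («the natural action of `Π_⊇/Π_⊆` on `Π_⊆`» at the level of `±`-label classes);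
* `FlTorsorStructure.IsConj F` — LAW (b): `F.conjAct g ⟦I⟧ = ⟦g I g⁻¹⟧` whenever both are cusps; under (a) this says
  `F.conjAct = hC.conjClass` (`isConj_iff_conjAct_eq_conjClass`);
* the bundled SUCCESSOR `FlTorsorStructureConj C extends FlTorsorStructure C` with the two wanted fields `conj_stable`,
  `conjAct_spec` VERBATIM as G-w5d243-1 asks, the constructor `ofConjClass` (chart + `quotIso` + the affine
  compatibility of GENUINE conjugation with the chart ⇒ an inhabitant), and the strengthened Def 2.3 (iii)–(v) existence
  predicate `Def23_structuresConj Dec C` (⇒ `Def23_structures`, `def23_structuresConj_iff`);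
* INTERFACE THEOREMS over every `(S, T, W, C)`: two `IsConj` structures have the SAME `conjAct` (`IsConj.conjAct_eq`) and,
  with the same chart, the SAME `quotIso` (`IsConj.quotIso_eq`, via p431735) — «hence DETERMINES»; through the chart
  genuine conjugation acts on labels by `x ↦ ±x + a`, `(a, ±1) = quotIso ḡ` (`IsConj.chart_conjClass`) — «preserves this
  `𝔽^±_l`-torsor structure»; and the kernel of the genuine conjugation action on `LabCusp^±(Π̂^±_v)` is EXACTLY `Π̂^±_v` as
  soon as one `IsConj` structure exists (`forall_conjClass_eq_self_iff`, via p430805) — the faithfulness of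
  `Π̂^cor_v/Π̂^±_v ≅ 𝔽_l^{⋊±}` on the `l` labels.

DELIBERATELY NOT HERE: witnesses (companion `FlTorsorStructureConjWitnesses.lean`: the wreath toy p433626 inhabits
`FlTorsorStructureConj`, the dihedral toy p427711 does not although it inhabits `FlTorsorStructure`; law (a) at the tower
of record `PlusMinusTower.ofPiCHat` is abc-iut-w5-d132's p432649); the tie of `chart` to the level-`Π_v` data of Def 2.3
(iii) («the images … of the various structures on `LabCusp^±(Π_v)`», cf. GAP-LEDGER G-w5d219-1's class) is not typed
here either.  No instance, no notation, no `Prop`-valued named fact; typed ≠ proved; consistency ≠ faithfulness; no side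
taken on [IUTchIII] Cor. 3.12; nothing here asserts abc proved or refuted.
-/

noncomputable section

open scoped Pointwise

namespace Literature.IUT.HodgeArakelov

universe u

/-! ## 0. Conjugation bookkeeping on subgroups (generic group theory) -/

section Generic

variable {G : Type*} [Group G]

/-- The pointwise conjugate `MulAut.conj g • H` is the image subgroup `H.map (MulAut.conj g)` (the two spellings used in
the abc-iut tree for `g H g⁻¹`; conjugation bookkeeping for Def 2.3 (iii)). [claim: Mochizuki2012, status: disputed] (IUTchII §2 Def 2.3 (iii), kurims p.68) -/
theorem conj_smul_eq_map_conj (g : G) (H : Subgroup G) :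
    MulAut.conj g • H = H.map (MulAut.conj g).toMonoidHom := rfl

/-- `H^{x y} = (H^y)^x` for conjugation of subgroups (bookkeeping for Def 2.3 (iii)). [claim: Mochizuki2012, status: disputed] (IUTchII §2 Def 2.3 (iii), kurims p.68) -/
theorem map_conj_mul (x y : G) (H : Subgroup G) :
    H.map (MulAut.conj (x * y)).toMonoidHom =
      (H.map (MulAut.conj y).toMonoidHom).map (MulAut.conj x).toMonoidHom := by
  rw [Subgroup.map_map, map_mul]; rfl

/-- `H^1 = H` (bookkeeping for Def 2.3 (iii)). [claim: Mochizuki2012, status: disputed] (IUTchII §2 Def 2.3 (iii), kurims p.68) -/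
theorem map_conj_one_eq_self (H : Subgroup G) : H.map (MulAut.conj (1 : G)).toMonoidHom = H := by
  rw [map_one]; ext x; simp

/-- A normal subgroup is fixed by every conjugation (`MulEquiv.toMonoidHom` spelling; here for `Π̂^±_v ⊴ Π̂^cor_v`, Def 2.3 (i)).
[claim: Mochizuki2012, status: disputed] (IUTchII §2 Def 2.3 (i), kurims p.67) -/
theorem map_conj_eq_self_of_normal (Q : Subgroup G) [Q.Normal] (n : G) :
    Q.map (MulAut.conj n).toMonoidHom = Q := by
  rw [MulEquiv.toMonoidHom_eq_coe]; exact Subgroup.Normal.map_conj_eq Q n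

/-- **`N_Q(X^n) = N_Q(X)^n`** (both pushed into the ambient group) for `X ≤ Q` and `n` normalising `Q`: the normaliser
bookkeeping of [IUTchII] Def 2.3 (iii)'s `labelRel` commutes with conjugation (generalises `FlTorsorWreathToy.normalizerMap_conj`
of p430441 from `n ∈ Q` to `n` normalising `Q`). [claim: Mochizuki2012, status: disputed] (IUTchII §2 Def 2.3 (iii), kurims p.68) -/
theorem normalizerMap_conj_of_map_conj_eq {Q X : Subgroup G} (hX : X ≤ Q) {n : G}
    (hQn : Q.map (MulAut.conj n).toMonoidHom = Q) :
    (Subgroup.normalizer ((((X.map (MulAut.conj n).toMonoidHom).subgroupOf Q : Subgroup Q)) : Set Q)).map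
        Q.subtype =
      ((Subgroup.normalizer ((X.subgroupOf Q : Subgroup Q) : Set Q)).map Q.subtype).map
        (MulAut.conj n).toMonoidHom := by
  have hXn : X.map (MulAut.conj n).toMonoidHom ≤ Q := (Subgroup.map_mono hX).trans_eq hQn
  rw [← Subgroup.subgroupOf_normalizer_eq hXn, ← Subgroup.subgroupOf_normalizer_eq hX,
    Subgroup.subgroupOf_map_subtype, Subgroup.subgroupOf_map_subtype,
    Subgroup.map_inf _ _ _ (MulAut.conj n).injective, hQn, ← Subgroup.map_equiv_normalizer_eq]

end Generic

variable {S : BadPlaceSetting.{u}} {P : TopGroup.{u}} {T : TemperedCoverings S P} {W : PlusMinusTower T}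

/-! ## 1. Law (a): the cusps of `Π̂^±_v` are permuted by `Π̂^cor_v`-conjugation -/

namespace CuspidalInertiaData

/-- **Law (a) of G-w5d243-1** ([IUTchII] Rmk 2.3.1, kurims p. 69: «since `Π^±_v` … is normal in `Π^cor_v` … the cuspidal
inertia groups … are permuted by the conjugation action of `Π^cor_v`»; hatted level of Def 2.3 (v)): for every
`g ∈ Π̂^cor_v`, a cuspidal inertia subgroup `I` of `Π̂^±_v` has `g I g⁻¹` again a cuspidal inertia subgroup of `Π̂^±_v`.
PREDICATE on abc-iut-L6-t1's interface `CuspidalInertiaData W` (the wanted field `conj_stable`).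
[claim: Mochizuki2012, status: disputed] (IUTchII §2 Rmk 2.3.1, kurims p.69) -/
def ConjStable (C : CuspidalInertiaData W) : Prop :=
  ∀ (g : W.Corhat) (I : Subgroup W.Corhat), C.IsCuspidalInertia W.pmHat I →
    C.IsCuspidalInertia W.pmHat (I.map (MulAut.conj g).toMonoidHom)

variable {C : CuspidalInertiaData W}

/-- Law (a) in the pointwise spelling `MulAut.conj g • I` (the form proved at the tower of record by abc-iut-w5-d132,
`PlusMinusTower.exists_cuspidalInertiaDataHat_ofPiCHat`). [claim: Mochizuki2012, status: disputed] (IUTchII §2 Rmk 2.3.1, kurims p.69) -/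
theorem conjStable_iff_smul :
    C.ConjStable ↔ ∀ (g : W.Corhat) (I : Subgroup W.Corhat), C.IsCuspidalInertia W.pmHat I →
      C.IsCuspidalInertia W.pmHat (MulAut.conj g • I) :=
  Iff.rfl

/-- Under law (a), `Π̂^cor_v`-conjugation preserves the relation `labelRel` of Def 2.3 (iii) on cuspidal inertia
subgroups of `Π̂^±_v` (normalisers `Π̂^±_v`-conjugate): `N(J) = N(I)^n` ⇒ `N(J^g) = N(I^g)^{g n g⁻¹}`, because `g`
normalises `Π̂^±_v`. [claim: Mochizuki2012, status: disputed] (IUTchII §2 Def 2.3 (iii), kurims p.68) -/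
theorem ConjStable.labelRel_conj (hC : C.ConjStable) (g : W.Corhat)
    {I J : {I // C.IsCuspidalInertia W.pmHat I}} (h : labelRel C W.pmHat W.pmHat I J) :
    labelRel C W.pmHat W.pmHat ⟨_, hC g I.1 I.2⟩ ⟨_, hC g J.1 J.2⟩ := by
  obtain ⟨n, hn, hN⟩ := h
  refine ⟨g * n * g⁻¹, W.pmHat_normal.conj_mem n hn g, ?_⟩
  change (Subgroup.normalizer ((((J.1.map (MulAut.conj g).toMonoidHom).subgroupOf W.pmHat : Subgroup W.pmHat)) :
      Set W.pmHat)).map W.pmHat.subtype =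
    ((Subgroup.normalizer ((((I.1.map (MulAut.conj g).toMonoidHom).subgroupOf W.pmHat : Subgroup W.pmHat)) :
      Set W.pmHat)).map W.pmHat.subtype).map (MulAut.conj (g * n * g⁻¹)).toMonoidHom
  rw [normalizerMap_conj_of_map_conj_eq (C.le_of_isCuspidalInertia J.2) (map_conj_eq_self_of_normal _ g),
    normalizerMap_conj_of_map_conj_eq (C.le_of_isCuspidalInertia I.2) (map_conj_eq_self_of_normal _ g), hN,
    ← map_conj_mul, ← map_conj_mul, inv_mul_cancel_right]

/-- **Conjugation DESCENDS to `±`-label classes** under law (a): `⟦I⟧ ↦ ⟦g I g⁻¹⟧` on `LabCusp^±(Π̂^±_v)` — the GENUINE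
«natural action of `Π_⊇` on `Π_⊆`» of Def 2.3 (v) at the level of label classes (DATA, well defined by `labelRel_conj`).
[claim: Mochizuki2012, status: disputed] (IUTchII §2 Def 2.3 (v), kurims p.69) -/
def ConjStable.conjClass (hC : C.ConjStable) (g : W.Corhat) :
    LabCuspPM C W.pmHat W.pmHat → LabCuspPM C W.pmHat W.pmHat :=
  Quot.lift (fun I => Quot.mk _ ⟨I.1.map (MulAut.conj g).toMonoidHom, hC g I.1 I.2⟩)
    (fun _ _ h => Quot.sound (hC.labelRel_conj g h))

/-- `conjClass g ⟦I⟧ = ⟦g I g⁻¹⟧` (by `rfl`). [claim: Mochizuki2012, status: disputed] (IUTchII §2 Def 2.3 (v), kurims p.69) -/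
theorem ConjStable.conjClass_mk (hC : C.ConjStable) (g : W.Corhat) (I : Subgroup W.Corhat)
    (hI : C.IsCuspidalInertia W.pmHat I) :
    hC.conjClass g (Quot.mk _ ⟨I, hI⟩) = Quot.mk _ ⟨I.map (MulAut.conj g).toMonoidHom, hC g I hI⟩ := rfl

/-- `conjClass 1 = id`. [claim: Mochizuki2012, status: disputed] (IUTchII §2 Def 2.3 (v), kurims p.69) -/
theorem ConjStable.conjClass_one (hC : C.ConjStable) (t : LabCuspPM C W.pmHat W.pmHat) : hC.conjClass 1 t = t := by
  induction t using Quot.ind with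
  | mk I => exact congrArg (Quot.mk _) (Subtype.ext (map_conj_one_eq_self I.1))

/-- `conjClass (g g') = conjClass g ∘ conjClass g'` — a `Π̂^cor_v`-ACTION on `LabCusp^±(Π̂^±_v)`.
[claim: Mochizuki2012, status: disputed] (IUTchII §2 Def 2.3 (v), kurims p.69) -/
theorem ConjStable.conjClass_mul (hC : C.ConjStable) (g g' : W.Corhat) (t : LabCuspPM C W.pmHat W.pmHat) :
    hC.conjClass (g * g') t = hC.conjClass g (hC.conjClass g' t) := by
  induction t using Quot.ind with
  | mk I => exact congrArg (Quot.mk _) (Subtype.ext (map_conj_mul g g' I.1))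

/-- **The action is TRIVIAL on `Π̂^±_v`**: for `g ∈ Π̂^±_v`, `⟦g I g⁻¹⟧ = ⟦I⟧` (the witness of `labelRel` is `g` itself:
`N(I^g) = N(I)^g`) — so `conjClass` is an action of `Π_⊇/Π_⊆ = Π̂^cor_v/Π̂^±_v`.
[claim: Mochizuki2012, status: disputed] (IUTchII §2 Def 2.3 (v), kurims p.69) -/
theorem ConjStable.conjClass_eq_self_of_mem_pmHat (hC : C.ConjStable) {g : W.Corhat} (hg : g ∈ W.pmHat)
    (t : LabCuspPM C W.pmHat W.pmHat) : hC.conjClass g t = t := by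
  induction t using Quot.ind with
  | mk I =>
    exact (Quot.sound ⟨g, hg, normalizerMap_conj_of_map_conj_eq (C.le_of_isCuspidalInertia I.2)
      (map_conj_eq_self_of_normal _ g)⟩).symm

/-- `conjClass g` depends only on the class of `g` in `Π̂^cor_v/Π̂^±_v`.
[claim: Mochizuki2012, status: disputed] (IUTchII §2 Def 2.3 (v), kurims p.69) -/
theorem ConjStable.conjClass_eq_of_quotient_eq (hC : C.ConjStable) {g g' : W.Corhat}
    (h : (QuotientGroup.mk g : W.Corhat ⧸ W.pmHat) = QuotientGroup.mk g') (t : LabCuspPM C W.pmHat W.pmHat) :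
    hC.conjClass g t = hC.conjClass g' t := by
  have hmem : g⁻¹ * g' ∈ W.pmHat := QuotientGroup.eq.mp h
  have e : g' = g * (g⁻¹ * g') := by rw [mul_inv_cancel_left]
  rw [e, hC.conjClass_mul, hC.conjClass_eq_self_of_mem_pmHat hmem]

/-- `conjClass g` is a bijection of `LabCusp^±(Π̂^±_v)` (inverse `conjClass g⁻¹`).
[claim: Mochizuki2012, status: disputed] (IUTchII §2 Def 2.3 (v), kurims p.69) -/
def ConjStable.conjClassEquiv (hC : C.ConjStable) (g : W.Corhat) :
    LabCuspPM C W.pmHat W.pmHat ≃ LabCuspPM C W.pmHat W.pmHat where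
  toFun := hC.conjClass g
  invFun := hC.conjClass g⁻¹
  left_inv t := by rw [← hC.conjClass_mul, inv_mul_cancel, hC.conjClass_one]
  right_inv t := by rw [← hC.conjClass_mul, mul_inv_cancel, hC.conjClass_one]

end CuspidalInertiaData

/-! ## 2. Law (b): the interface field `conjAct` IS conjugation -/

namespace FlTorsorStructure

open Literature.IUT.HodgeTheaters

variable {C : CuspidalInertiaData W}

/-- **Law (b) of G-w5d243-1** ([IUTchII] Def 2.3 (v), kurims p. 69: «the conjugation action of `Π̂^cor_v` on label
classes»): the interface field `F.conjAct` AGREES WITH CONJUGATION of cuspidal inertia subgroups — `F.conjAct g ⟦I⟧ = ⟦g I g⁻¹⟧`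
whenever `g I g⁻¹` is again a cusp of `Π̂^±_v` (stated over the proof `hgI`, so that it needs no law (a) to make sense; the
form refuted on the dihedral toy by `FlTorsorToy.not_exists_conjAct_eq_conj`, p430806). PREDICATE on abc-iut-L6-t1's
`FlTorsorStructure C`. [claim: Mochizuki2012, status: disputed] (IUTchII §2 Def 2.3 (v), kurims p.69) -/
def IsConj (F : FlTorsorStructure C) : Prop :=
  ∀ (g : W.Corhat) (I : Subgroup W.Corhat) (hI : C.IsCuspidalInertia W.pmHat I)
    (hgI : C.IsCuspidalInertia W.pmHat (I.map (MulAut.conj g).toMonoidHom)),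
    F.conjAct g (Quot.mk _ ⟨I, hI⟩) = Quot.mk _ ⟨I.map (MulAut.conj g).toMonoidHom, hgI⟩

variable {F : FlTorsorStructure C}

/-- Under law (a), law (b) says exactly `F.conjAct = conjClass` (the descended conjugation action).
[claim: Mochizuki2012, status: disputed] (IUTchII §2 Def 2.3 (v), kurims p.69) -/
theorem isConj_iff_conjAct_eq_conjClass (hC : C.ConjStable) :
    F.IsConj ↔ ∀ g t, F.conjAct g t = hC.conjClass g t := by
  constructor
  · intro hF g t
    induction t using Quot.ind with
    | mk I => exact hF g I.1 I.2 (hC g I.1 I.2)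
  · intro h g I hI hgI
    rw [h]; rfl

/-- Law (b) as an equality of functions `F.conjAct = hC.conjClass`. [claim: Mochizuki2012, status: disputed] (IUTchII §2 Def 2.3 (v), kurims p.69) -/
theorem IsConj.conjAct_eq_conjClass (hF : F.IsConj) (hC : C.ConjStable) : F.conjAct = hC.conjClass :=
  funext fun g => funext fun t => (isConj_iff_conjAct_eq_conjClass hC).mp hF g t

/-- **«hence DETERMINES» (i): the action is determined** — two `IsConj` structures over a law-(a) datum have the SAME
`conjAct`. [claim: Mochizuki2012, status: disputed] (IUTchII §2 Def 2.3 (v), kurims p.69) -/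
theorem IsConj.conjAct_eq (hC : C.ConjStable) {F F' : FlTorsorStructure C} (hF : F.IsConj) (hF' : F'.IsConj) :
    F.conjAct = F'.conjAct := by
  rw [hF.conjAct_eq_conjClass hC, hF'.conjAct_eq_conjClass hC]

/-- **«hence DETERMINES» (ii): the outer isomorphism is determined by the chart** — two `IsConj` structures with the
same chart `LabCusp^±(Π̂^±_v) ≃ 𝔽_l` have the SAME `quotIso : Π̂^cor_v/Π̂^±_v ≃* 𝔽_l^{⋊±}` (via
`quotIso_eq_of_chart_eq_of_conjAct_eq'`, p431735). [claim: Mochizuki2012, status: disputed] (IUTchII §2 Def 2.3 (v), kurims p.69) -/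
theorem IsConj.quotIso_eq (hC : C.ConjStable) {F F' : FlTorsorStructure C} (hF : F.IsConj) (hF' : F'.IsConj)
    (hchart : F.chart = F'.chart) : F.quotIso = F'.quotIso :=
  quotIso_eq_of_chart_eq_of_conjAct_eq' F F' hchart (hF.conjAct_eq hC hF')

/-- **«preserves this `𝔽^±_l`-torsor structure»**: through the chart, GENUINE conjugation by `g` acts on the `l` label
classes by the affine map `x ↦ ±x + a`, `(a, ±1) = quotIso ḡ ∈ 𝔽_l ⋊ {±1}`.
[claim: Mochizuki2012, status: disputed] (IUTchII §2 Def 2.3 (v), kurims p.69) -/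
theorem IsConj.chart_conjClass (hF : F.IsConj) (hC : C.ConjStable) (g : W.Corhat) (t : LabCuspPM C W.pmHat W.pmHat) :
    F.chart (hC.conjClass g t) =
      Multiplicative.toAdd (F.quotIso (QuotientGroup.mk g)).left +
        ((F.quotIso (QuotientGroup.mk g)).right : ℤ) * F.chart t := by
  rw [← (isConj_iff_conjAct_eq_conjClass hC).mp hF g t]
  exact F.conjAct_chart g t

/-- **The kernel of the GENUINE conjugation action on `LabCusp^±(Π̂^±_v)` is EXACTLY `Π̂^±_v`** as soon as one `IsConj`
structure exists (`⊇` is `conjClass_eq_self_of_mem_pmHat` unconditionally; `⊆` is the faithfulness theorem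
`forall_conjAct_eq_self_iff` of p430805 transported along law (b)): `Π̂^cor_v/Π̂^±_v ≅ 𝔽_l^{⋊±}` acts faithfully on the
`l` labels. [claim: Mochizuki2012, status: disputed] (IUTchII §2 Def 2.3 (v), kurims p.69) -/
theorem IsConj.forall_conjClass_eq_self_iff (hF : F.IsConj) (hC : C.ConjStable) (g : W.Corhat) :
    (∀ t, hC.conjClass g t = t) ↔ g ∈ W.pmHat := by
  rw [← F.forall_conjAct_eq_self_iff g, hF.conjAct_eq_conjClass hC]

/-- Contrapositive: an element OUTSIDE `Π̂^±_v` moves some `±`-label class BY CONJUGATION (given an `IsConj` structure).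
[claim: Mochizuki2012, status: disputed] (IUTchII §2 Def 2.3 (v), kurims p.69) -/
theorem IsConj.exists_conjClass_ne_self (hF : F.IsConj) (hC : C.ConjStable) {g : W.Corhat} (hg : g ∉ W.pmHat) :
    ∃ t, hC.conjClass g t ≠ t :=
  not_forall.mp fun h => hg ((hF.forall_conjClass_eq_self_iff hC g).mp h)

end FlTorsorStructure

/-! ## 3. The bundled successor `FlTorsorStructureConj` and the strengthened existence predicate -/

/-- **IUTchII:Def2.3(v), SUCCESSOR INTERFACE** (kurims p. 69): abc-iut-L6-t1's `FlTorsorStructure C` EXTENDED by the two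
laws wanted by GAP-LEDGER G-w5d243-1, verbatim — (a) `conj_stable`: the cusps of `Π̂^±_v` are permuted by
`Π̂^cor_v`-conjugation (Rmk 2.3.1); (b) `conjAct_spec`: the label action `conjAct g ⟦I⟧ = ⟦g I g⁻¹⟧` IS conjugation («the
natural action of `Π_⊇/Π_⊆` on `Π_⊆` preserves this `𝔽^±_l`-torsor structure, hence determines a natural outer isomorphism
`Π_⊇/Π_⊆ ≅ 𝔽_l^{⋊±}`»). DATA. [claim: Mochizuki2012, status: disputed] (IUTchII §2 Def 2.3 (v), kurims p.69) -/
structure FlTorsorStructureConj (C : CuspidalInertiaData W) extends FlTorsorStructure C where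
  /-- law (a): cuspidal inertia subgroups of `Π̂^±_v` are permuted by `Π̂^cor_v`-conjugation -/
  conj_stable : C.ConjStable
  /-- law (b): `conjAct` IS conjugation of cuspidal inertia subgroups -/
  conjAct_spec : ∀ (g : W.Corhat) (I : Subgroup W.Corhat) (hI : C.IsCuspidalInertia W.pmHat I),
    conjAct g (Quot.mk _ ⟨I, hI⟩) = Quot.mk _ ⟨I.map (MulAut.conj g).toMonoidHom, conj_stable g I hI⟩

namespace FlTorsorStructureConj

open Literature.IUT.HodgeTheaters

variable {C : CuspidalInertiaData W}

/-- The underlying `FlTorsorStructure` of a successor structure satisfies law (b) `IsConj`.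
[claim: Mochizuki2012, status: disputed] (IUTchII §2 Def 2.3 (v), kurims p.69) -/
theorem isConj (F : FlTorsorStructureConj C) : F.toFlTorsorStructure.IsConj :=
  fun g I hI _ => F.conjAct_spec g I hI

/-- `F.conjAct = conjClass` for a successor structure. [claim: Mochizuki2012, status: disputed] (IUTchII §2 Def 2.3 (v), kurims p.69) -/
theorem conjAct_eq_conjClass (F : FlTorsorStructureConj C) (g : W.Corhat) (t : LabCuspPM C W.pmHat W.pmHat) :
    F.conjAct g t = F.conj_stable.conjClass g t :=
  (FlTorsorStructure.isConj_iff_conjAct_eq_conjClass F.conj_stable).mp F.isConj g t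

/-- Packaging: an `FlTorsorStructure` satisfying law (b) over a law-(a) datum IS a successor structure.
[claim: Mochizuki2012, status: disputed] (IUTchII §2 Def 2.3 (v), kurims p.69) -/
def ofIsConj (F : FlTorsorStructure C) (hC : C.ConjStable) (hF : F.IsConj) : FlTorsorStructureConj C where
  toFlTorsorStructure := F
  conj_stable := hC
  conjAct_spec g I hI := hF g I hI (hC g I hI)

/-- `ofIsConj` does not change the underlying structure. [claim: Mochizuki2012, status: disputed] (IUTchII §2 Def 2.3 (v), kurims p.69) -/
theorem toFlTorsorStructure_ofIsConj (F : FlTorsorStructure C) (hC : C.ConjStable) (hF : F.IsConj) :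
    (ofIsConj F hC hF).toFlTorsorStructure = F := rfl

/-- **CONSTRUCTOR from genuine data**: a law-(a) datum, a chart `LabCusp^±(Π̂^±_v) ≃ 𝔽_l`, an isomorphism
`Π̂^cor_v/Π̂^±_v ≃* 𝔽_l^{⋊±}`, and the compatibility «GENUINE conjugation by `g` relabels through the chart by the affine map
of `quotIso ḡ`» give a successor structure whose `conjAct` is `conjClass` — the shape in which a model (e.g. the wreath toy
p433626, or a future genuine producer) discharges Def 2.3 (v) with its conjugation action.
[claim: Mochizuki2012, status: disputed] (IUTchII §2 Def 2.3 (v), kurims p.69) -/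
def ofConjClass (hC : C.ConjStable) (chart : LabCuspPM C W.pmHat W.pmHat ≃ ZMod S.l)
    (quotIso : W.Corhat ⧸ W.pmHat ≃* FlPM S.l)
    (hcompat : ∀ (g : W.Corhat) (t : LabCuspPM C W.pmHat W.pmHat),
      chart (hC.conjClass g t) =
        Multiplicative.toAdd (quotIso (QuotientGroup.mk g)).left +
          ((quotIso (QuotientGroup.mk g)).right : ℤ) * chart t) :
    FlTorsorStructureConj C where
  chart := chart
  quotIso := quotIso
  conjAct := hC.conjClass
  conjAct_chart := hcompat
  conj_stable := hC
  conjAct_spec _ _ _ := rfl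

/-- The constructor's action is `conjClass`. [claim: Mochizuki2012, status: disputed] (IUTchII §2 Def 2.3 (v), kurims p.69) -/
theorem conjAct_ofConjClass (hC : C.ConjStable) (chart : LabCuspPM C W.pmHat W.pmHat ≃ ZMod S.l)
    (quotIso : W.Corhat ⧸ W.pmHat ≃* FlPM S.l) (hcompat : _) :
    (ofConjClass hC chart quotIso hcompat).conjAct = hC.conjClass := rfl

/-- Inhabitation of the successor ⟺ law (a) holds and some `FlTorsorStructure` satisfies law (b).
[claim: Mochizuki2012, status: disputed] (IUTchII §2 Def 2.3 (v), kurims p.69) -/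
theorem nonempty_iff : Nonempty (FlTorsorStructureConj C) ↔ C.ConjStable ∧ ∃ F : FlTorsorStructure C, F.IsConj :=
  ⟨fun ⟨F⟩ => ⟨F.conj_stable, F.toFlTorsorStructure, F.isConj⟩, fun ⟨hC, F, hF⟩ => ⟨ofIsConj F hC hF⟩⟩

/-- Two successor structures have the SAME label action. [claim: Mochizuki2012, status: disputed] (IUTchII §2 Def 2.3 (v), kurims p.69) -/
theorem conjAct_eq (F F' : FlTorsorStructureConj C) : F.conjAct = F'.conjAct :=
  F.isConj.conjAct_eq F.conj_stable F'.isConj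

/-- Two successor structures with the same chart have the SAME outer isomorphism `Π̂^cor_v/Π̂^±_v ≃* 𝔽_l^{⋊±}`.
[claim: Mochizuki2012, status: disputed] (IUTchII §2 Def 2.3 (v), kurims p.69) -/
theorem quotIso_eq_of_chart_eq (F F' : FlTorsorStructureConj C) (h : F.chart = F'.chart) : F.quotIso = F'.quotIso :=
  F.isConj.quotIso_eq F.conj_stable F'.isConj h

/-- For a successor structure, `g` fixes every `±`-label class BY CONJUGATION iff `g ∈ Π̂^±_v`.
[claim: Mochizuki2012, status: disputed] (IUTchII §2 Def 2.3 (v), kurims p.69) -/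
theorem forall_conjClass_eq_self_iff (F : FlTorsorStructureConj C) (g : W.Corhat) :
    (∀ t, F.conj_stable.conjClass g t = t) ↔ g ∈ W.pmHat :=
  F.isConj.forall_conjClass_eq_self_iff F.conj_stable g

end FlTorsorStructureConj

/-- **IUTchII:Def2.3(iii)–(v) existence, STRENGTHENED** (kurims pp. 68–69, «one verifies immediately»): the label-class
structures exist over the group-theoretic data WITH the `𝔽^±_l`-torsor structure's label action BEING conjugation — the
successor of abc-iut-L6-t1's `Def23_structures Dec C` (whose `FlTorsorStructure` conjunct is replaced by
`FlTorsorStructureConj`). PREDICATE on `(Dec, C)`. [claim: Mochizuki2012, status: disputed] (IUTchII §2 Def 2.3 (v), kurims p.69) -/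
def Def23_structuresConj {D : EtaleThetaData S.toThetaSetting P} (Dec : SubgraphDecomposition S T D)
    (C : CuspidalInertiaData W) : Prop :=
  ∃ (L : LabCuspStructure C), Nonempty (LabelledDecomposition Dec L) ∧ Nonempty (FlTorsorStructureConj C)

/-- The strengthened predicate implies the typed one. [claim: Mochizuki2012, status: disputed] (IUTchII §2 Def 2.3 (v), kurims p.69) -/
theorem Def23_structuresConj.def23_structures {D : EtaleThetaData S.toThetaSetting P}
    {Dec : SubgraphDecomposition S T D} {C : CuspidalInertiaData W} (h : Def23_structuresConj Dec C) :
    Def23_structures Dec C := by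
  obtain ⟨L, hL, ⟨F⟩⟩ := h
  exact ⟨L, hL, ⟨F.toFlTorsorStructure⟩⟩

/-- `Def23_structuresConj ⟺ Def23_structures ∧ law (a) ∧ (∃ F, law (b))`.
[claim: Mochizuki2012, status: disputed] (IUTchII §2 Def 2.3 (v), kurims p.69) -/
theorem def23_structuresConj_iff {D : EtaleThetaData S.toThetaSetting P} (Dec : SubgraphDecomposition S T D)
    (C : CuspidalInertiaData W) :
    Def23_structuresConj Dec C ↔
      Def23_structures Dec C ∧ C.ConjStable ∧ ∃ F : FlTorsorStructure C, F.IsConj := by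
  constructor
  · intro h
    obtain ⟨L, hL, hF⟩ := h
    exact ⟨⟨L, hL, ⟨(Classical.choice hF).toFlTorsorStructure⟩⟩, FlTorsorStructureConj.nonempty_iff.mp hF⟩
  · rintro ⟨⟨L, hL, -⟩, h⟩
    exact ⟨L, hL, FlTorsorStructureConj.nonempty_iff.mpr h⟩

/-- Law (b) can fail where the typed predicate holds: if NO `FlTorsorStructure C` satisfies `IsConj` then
`Def23_structuresConj Dec C` fails (for every `Dec`) — the form in which the dihedral toy p427711 separates the two
predicates (companion witnesses file). [claim: Mochizuki2012, status: disputed] (IUTchII §2 Def 2.3 (v), kurims p.69) -/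
theorem not_def23_structuresConj_of_forall_not_isConj {D : EtaleThetaData S.toThetaSetting P}
    (Dec : SubgraphDecomposition S T D) (C : CuspidalInertiaData W) (h : ∀ F : FlTorsorStructure C, ¬ F.IsConj) :
    ¬ Def23_structuresConj Dec C := by
  rintro ⟨-, -, ⟨F⟩⟩
  exact h F.toFlTorsorStructure F.isConj

end Literature.IUT.HodgeArakelov

end
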